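import Summits.AtomisticToContinuum.HydrodynamicLimit.Theses.OneFlightGossipEngine
import Summits.AtomisticToContinuum.HydrodynamicLimit.Theorems.KineticCurrentsWindowLDUniform.Negative.LoadBearing
import HarnessLib

/-!
# `KineticCurrentsLDAlongFamilies` (crux stmt-AtomisticToContinuum-16659) INHERITS every refuted variant of its
# constant-family rung `KineticCurrentsWindowLDUniform` (stmt-14662): `∃ N₀`, `∃ β₀` and `F ⊥ v_j` are load-bearing

Standing disprover's lemmas (`Cruxes/KineticCurrentsLDAlongFamilies/Disproof.lean` §(b);
refuter-cdisprove-stmt-AtomisticToContinuum-16659-0, cycle 1). The crux (route OneFlightGossipEngine, rank 3, the docking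
node) is the kinetic window LD made UNIFORM along jointly continuous one-parameter families `s ↦ (a_s, θ_s, u_s; A_s, b_s,
G_s)`, `s ∈ [0,t₁]`, with the window quantifier `∃ τ₀ ∀ τ ≥ τ₀`. A CONSTANT family (`t₁ = 0`, everything independent of
`s`) is admissible, and at `τ = τ₀`, `s = 0` its conclusion is the conclusion of the pointwise rung
`OneFlightGossipEngine.KineticCurrentsWindowLDUniform` (stmt-14662, `∃ τ > 0 ∃ N₀`). The same specialisation maps each
VARIANT of the family crux (a quantifier strengthened / a hypothesis deleted, every other token verbatim) onto the
corresponding variant of the rung, which the rung's disprover REFUTED in the tree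
(`Theorems/KineticCurrentsWindowLDUniform/Negative/{ForallN, LoadBearing}.lean`). Hence, unconditionally:

* `KineticCurrentsLDAlongFamiliesAllN` (`∃ N₀ ∀ N ≥ N₀` ↦ `∀ N`) is FALSE (`not_kineticCurrentsLDAlongFamiliesAllN`, via
  `not_kineticCurrentsWindowLDUniformAllN`: one free sphere never decorrelates `v₀v₁`);
* `KineticCurrentsLDAlongFamiliesAllBeta` (`∃ β₀ > 0 ∀ |β| ≤ β₀` ↦ `∀ β`) is FALSE (`not_kineticCurrentsLDAlongFamiliesAllBeta`,
  via `not_kineticCurrentsWindowLDUniformAllBeta`: the window functional of `v₀v₁` is `+∞` for `β > 1 = 1/(2θλ_max)`,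
  for every flow and window — time averaging does not enlarge the static domain of finiteness; along a family
  `β₀ ≤ 1/(2 sup_{s,x} θ_s(x) λ_max(A_s(x)))`, finite by compactness of `[0,t₁] × 𝕋³`);
* `KineticCurrentsLDAlongFamiliesWithoutOrthMom` (the momentum row `F ⊥ v_j` deleted) is FALSE
  (`not_kineticCurrentsLDAlongFamiliesWithoutOrthMom`, via `not_kineticCurrentsWindowLDUniformWithoutOrthMom`: the
  functional of `v₀` is `≥ e^{(N+1)β²/2}` at every window, by the drift tilt `βe₀`).

The three `…_pointwise_of_family` reductions are the whole proof; the variants are stated VERBATIM from the route file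
(family typing) with the single modification named. The companion file `Negative/OrthScalars.lean` adds the scalar rows
(`F ⊥ 1, |v|²`, new at the family level) and the tree's `HydroLimitInBandNegative.kineticCurrentsWindowLDFamily_false_with_sigma_zero`
decides `0 < σ`. No Theses declaration is asserted positively; the variant `def`s are NOT citable facts.
-/

noncomputable section

namespace Summit.AtomisticToContinuum.HydrodynamicLimit.Theorems.KineticCurrentsLDAlongFamiliesNegative

open MeasureTheory
open Literature.MathematicalPhysics.KineticTheory Literature.Analysis.FluidPDE

/-! ## §1 `∃ N₀` is load-bearing -/

/-- **A FALSE proposition — NOT a citable fact.** The crux `OneFlightGossipEngine.KineticCurrentsLDAlongFamilies`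
(stmt-AtomisticToContinuum-16659) VERBATIM with `∃ N₀, ∀ N ≥ N₀` strengthened to `∀ N`; kept only as the statement that
`not_kineticCurrentsLDAlongFamiliesAllN` negates. -/
def KineticCurrentsLDAlongFamiliesAllN : Prop :=
  ∃ η₀ : ℝ, 0 < η₀ ∧ ∀ (t₁ : ℝ) (a θ₀ : ℝ → T3 → ℝ) (u₀ : ℝ → T3 → V3),
    Continuous (Function.uncurry a) → Continuous (Function.uncurry θ₀) → Continuous (Function.uncurry u₀) →
    (∀ s x, 0 < a s x) → (∀ s x, 0 < θ₀ s x) →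
    ∀ σ : ℝ, 0 < σ → (∀ s ∈ Set.Icc 0 t₁, σ ^ 3 * (⨆ x, a s x) ≤ η₀ * ∫ x, a s x) →
    ∀ Φ : (N : ℕ) → HardSphereFlow (Torus.geometry (Fin 3)) (hsDiameter σ N) (N + 1),
    ∀ (A : ℝ → T3 → Fin 3 → Fin 3 → ℝ) (b : ℝ → T3 → V3) (G : ℝ → T3 × ℝ → ℝ),
    Continuous (Function.uncurry A) → Continuous (Function.uncurry b) → Continuous (Function.uncurry G) →
    (let F := fun (s : ℝ) (y : T3 × V3) =>
       (∑ j : Fin 3, ∑ k : Fin 3, A s y.1 j k * ((y.2 - u₀ s y.1) j * (y.2 - u₀ s y.1) k)) +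
         (∑ j : Fin 3, b s y.1 j * (y.2 - u₀ s y.1) j) * G s (y.1, ‖y.2 - u₀ s y.1‖ ^ 2)
     (∃ C : ℝ, ∀ s ∈ Set.Icc 0 t₁, ∀ y : T3 × V3, |F s y| ≤ C * (1 + ‖y.2‖ ^ 2)) →
     (∀ s ∈ Set.Icc 0 t₁, ∀ x, ∫ v, F s (x, v) * localMaxwellian 1 (θ₀ s x) (u₀ s x) v = 0) →
     (∀ s ∈ Set.Icc 0 t₁, ∀ x (j : Fin 3),
        ∫ v, F s (x, v) * v j * localMaxwellian 1 (θ₀ s x) (u₀ s x) v = 0) →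
     (∀ s ∈ Set.Icc 0 t₁, ∀ x, ∫ v, F s (x, v) * ‖v‖ ^ 2 * localMaxwellian 1 (θ₀ s x) (u₀ s x) v = 0) →
     ∃ β₀ : ℝ, 0 < β₀ ∧ ∀ β : ℝ, |β| ≤ β₀ → ∀ ε : ℝ, 0 < ε → ∃ τ₀ : ℝ, 0 < τ₀ ∧ ∀ τ : ℝ, τ₀ ≤ τ →
     ∀ N : ℕ, ∀ s ∈ Set.Icc 0 t₁,
       ∫⁻ z, ENNReal.ofReal (Real.exp (β * ∑ i : Fin (N + 1),
           (τ * ((N : ℝ) + 1) ^ (-(1 / 3 : ℝ)))⁻¹ *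
             ∫ r in (0 : ℝ)..(τ * ((N : ℝ) + 1) ^ (-(1 / 3 : ℝ))), F s ((Φ N).flow r z i)))
         ∂(localGibbsLaw σ (a s) (u₀ s) (θ₀ s) N (Φ N)) ≤
       ENNReal.ofReal (Real.exp (ε * ((N : ℝ) + 1))))

/-- The constant-family specialisation maps the `∀ N` variant of the family crux onto the `∀ N` variant of the rung. [folklore] -/
theorem allN_pointwise_of_family (h : KineticCurrentsLDAlongFamiliesAllN) : KineticCurrentsWindowLDUniformAllN := by
  obtain ⟨η₀, hη₀, H⟩ := h
  refine ⟨η₀, hη₀, ?_⟩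
  intro a θ₀ u₀ ha hθ hu ha0 hθ0 σ hσ hg Φ A b G hA hb hG hC h1 hv hE
  have H1 := H 0 (fun _ => a) (fun _ => θ₀) (fun _ => u₀) (ha.comp continuous_snd) (hθ.comp continuous_snd)
    (hu.comp continuous_snd) (fun _ x => ha0 x) (fun _ x => hθ0 x) σ hσ (fun _ _ => hg) Φ (fun _ => A) (fun _ => b)
    (fun _ => G) (hA.comp continuous_snd) (hb.comp continuous_snd) (hG.comp continuous_snd)
  dsimp only at H1 hC h1 hv hE ⊢
  obtain ⟨C, hC⟩ := hC
  obtain ⟨β₀, hβ₀, Hβ⟩ := H1 ⟨C, fun _ _ y => hC y⟩ (fun _ _ x => h1 x) (fun _ _ x j => hv x j) (fun _ _ x => hE x)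
  refine ⟨β₀, hβ₀, fun β hβ ε hε => ?_⟩
  obtain ⟨τ₀, hτ₀, Hτ⟩ := Hβ β hβ ε hε
  exact ⟨τ₀, hτ₀, fun N => Hτ τ₀ le_rfl N 0 ⟨le_rfl, le_rfl⟩⟩

/-- **`∃ N₀` IS LOAD-BEARING for the family crux**: its `∀ N` strengthening is false (one free sphere, `N = 0`, keeps
`v₀v₁` frozen at every window; inherited from the rung). [folklore] -/
theorem not_kineticCurrentsLDAlongFamiliesAllN : ¬ KineticCurrentsLDAlongFamiliesAllN :=
  fun h => not_kineticCurrentsWindowLDUniformAllN (allN_pointwise_of_family h)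

/-! ## §2 `∃ β₀` is load-bearing -/

/-- **A FALSE proposition — NOT a citable fact.** The crux `OneFlightGossipEngine.KineticCurrentsLDAlongFamilies`
(stmt-AtomisticToContinuum-16659) VERBATIM with `∃ β₀ > 0, ∀ β, |β| ≤ β₀ →` strengthened to `∀ β`; kept only as the
statement that `not_kineticCurrentsLDAlongFamiliesAllBeta` negates. -/
def KineticCurrentsLDAlongFamiliesAllBeta : Prop :=
  ∃ η₀ : ℝ, 0 < η₀ ∧ ∀ (t₁ : ℝ) (a θ₀ : ℝ → T3 → ℝ) (u₀ : ℝ → T3 → V3),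
    Continuous (Function.uncurry a) → Continuous (Function.uncurry θ₀) → Continuous (Function.uncurry u₀) →
    (∀ s x, 0 < a s x) → (∀ s x, 0 < θ₀ s x) →
    ∀ σ : ℝ, 0 < σ → (∀ s ∈ Set.Icc 0 t₁, σ ^ 3 * (⨆ x, a s x) ≤ η₀ * ∫ x, a s x) →
    ∀ Φ : (N : ℕ) → HardSphereFlow (Torus.geometry (Fin 3)) (hsDiameter σ N) (N + 1),
    ∀ (A : ℝ → T3 → Fin 3 → Fin 3 → ℝ) (b : ℝ → T3 → V3) (G : ℝ → T3 × ℝ → ℝ),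
    Continuous (Function.uncurry A) → Continuous (Function.uncurry b) → Continuous (Function.uncurry G) →
    (let F := fun (s : ℝ) (y : T3 × V3) =>
       (∑ j : Fin 3, ∑ k : Fin 3, A s y.1 j k * ((y.2 - u₀ s y.1) j * (y.2 - u₀ s y.1) k)) +
         (∑ j : Fin 3, b s y.1 j * (y.2 - u₀ s y.1) j) * G s (y.1, ‖y.2 - u₀ s y.1‖ ^ 2)
     (∃ C : ℝ, ∀ s ∈ Set.Icc 0 t₁, ∀ y : T3 × V3, |F s y| ≤ C * (1 + ‖y.2‖ ^ 2)) →
     (∀ s ∈ Set.Icc 0 t₁, ∀ x, ∫ v, F s (x, v) * localMaxwellian 1 (θ₀ s x) (u₀ s x) v = 0) →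
     (∀ s ∈ Set.Icc 0 t₁, ∀ x (j : Fin 3),
        ∫ v, F s (x, v) * v j * localMaxwellian 1 (θ₀ s x) (u₀ s x) v = 0) →
     (∀ s ∈ Set.Icc 0 t₁, ∀ x, ∫ v, F s (x, v) * ‖v‖ ^ 2 * localMaxwellian 1 (θ₀ s x) (u₀ s x) v = 0) →
     ∀ β : ℝ, ∀ ε : ℝ, 0 < ε → ∃ τ₀ : ℝ, 0 < τ₀ ∧ ∀ τ : ℝ, τ₀ ≤ τ →
     ∃ N₀ : ℕ, ∀ N : ℕ, N₀ ≤ N → ∀ s ∈ Set.Icc 0 t₁,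
       ∫⁻ z, ENNReal.ofReal (Real.exp (β * ∑ i : Fin (N + 1),
           (τ * ((N : ℝ) + 1) ^ (-(1 / 3 : ℝ)))⁻¹ *
             ∫ r in (0 : ℝ)..(τ * ((N : ℝ) + 1) ^ (-(1 / 3 : ℝ))), F s ((Φ N).flow r z i)))
         ∂(localGibbsLaw σ (a s) (u₀ s) (θ₀ s) N (Φ N)) ≤
       ENNReal.ofReal (Real.exp (ε * ((N : ℝ) + 1))))

/-- The constant-family specialisation maps the `∀ β` variant of the family crux onto the `∀ β` variant of the rung. [folklore] -/
theorem allBeta_pointwise_of_family (h : KineticCurrentsLDAlongFamiliesAllBeta) : KineticCurrentsWindowLDUniformAllBeta := by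
  obtain ⟨η₀, hη₀, H⟩ := h
  refine ⟨η₀, hη₀, ?_⟩
  intro a θ₀ u₀ ha hθ hu ha0 hθ0 σ hσ hg Φ A b G hA hb hG hC h1 hv hE β ε hε
  have H1 := H 0 (fun _ => a) (fun _ => θ₀) (fun _ => u₀) (ha.comp continuous_snd) (hθ.comp continuous_snd)
    (hu.comp continuous_snd) (fun _ x => ha0 x) (fun _ x => hθ0 x) σ hσ (fun _ _ => hg) Φ (fun _ => A) (fun _ => b)
    (fun _ => G) (hA.comp continuous_snd) (hb.comp continuous_snd) (hG.comp continuous_snd)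
  dsimp only at H1 hC h1 hv hE ⊢
  obtain ⟨C, hC⟩ := hC
  obtain ⟨τ₀, hτ₀, Hτ⟩ := H1 ⟨C, fun _ _ y => hC y⟩ (fun _ _ x => h1 x) (fun _ _ x j => hv x j) (fun _ _ x => hE x)
    β ε hε
  obtain ⟨N₀, HN⟩ := Hτ τ₀ le_rfl
  exact ⟨τ₀, hτ₀, N₀, fun N hN => HN N hN 0 ⟨le_rfl, le_rfl⟩⟩

/-- **`∃ β₀` IS LOAD-BEARING for the family crux, QUANTITATIVELY**: its `∀ β` strengthening is false (shear stress `v₀v₁`,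
`β = 2 > 1`: the functional is `+∞` for every flow and window; inherited from the rung). Along a family the admissible
range is `β₀ ≤ 1/(2 sup_{s ∈ [0,t₁], x} θ_s(x) λ_max(A_s(x)))`, uniformly in `τ`. [folklore] -/
theorem not_kineticCurrentsLDAlongFamiliesAllBeta : ¬ KineticCurrentsLDAlongFamiliesAllBeta :=
  fun h => not_kineticCurrentsWindowLDUniformAllBeta (allBeta_pointwise_of_family h)

/-! ## §3 `F ⊥ v_j` is load-bearing -/

/-- **A FALSE proposition — NOT a citable fact.** The crux `OneFlightGossipEngine.KineticCurrentsLDAlongFamilies`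
(stmt-AtomisticToContinuum-16659) VERBATIM with the hypothesis `∀ s ∈ [0,t₁] ∀ x j, ∫ F_s(x,v) v_j M_{1,u_s(x),θ_s(x)}(v) dv = 0`
DELETED; kept only as the statement that `not_kineticCurrentsLDAlongFamiliesWithoutOrthMom` negates. -/
def KineticCurrentsLDAlongFamiliesWithoutOrthMom : Prop :=
  ∃ η₀ : ℝ, 0 < η₀ ∧ ∀ (t₁ : ℝ) (a θ₀ : ℝ → T3 → ℝ) (u₀ : ℝ → T3 → V3),
    Continuous (Function.uncurry a) → Continuous (Function.uncurry θ₀) → Continuous (Function.uncurry u₀) →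
    (∀ s x, 0 < a s x) → (∀ s x, 0 < θ₀ s x) →
    ∀ σ : ℝ, 0 < σ → (∀ s ∈ Set.Icc 0 t₁, σ ^ 3 * (⨆ x, a s x) ≤ η₀ * ∫ x, a s x) →
    ∀ Φ : (N : ℕ) → HardSphereFlow (Torus.geometry (Fin 3)) (hsDiameter σ N) (N + 1),
    ∀ (A : ℝ → T3 → Fin 3 → Fin 3 → ℝ) (b : ℝ → T3 → V3) (G : ℝ → T3 × ℝ → ℝ),
    Continuous (Function.uncurry A) → Continuous (Function.uncurry b) → Continuous (Function.uncurry G) →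
    (let F := fun (s : ℝ) (y : T3 × V3) =>
       (∑ j : Fin 3, ∑ k : Fin 3, A s y.1 j k * ((y.2 - u₀ s y.1) j * (y.2 - u₀ s y.1) k)) +
         (∑ j : Fin 3, b s y.1 j * (y.2 - u₀ s y.1) j) * G s (y.1, ‖y.2 - u₀ s y.1‖ ^ 2)
     (∃ C : ℝ, ∀ s ∈ Set.Icc 0 t₁, ∀ y : T3 × V3, |F s y| ≤ C * (1 + ‖y.2‖ ^ 2)) →
     (∀ s ∈ Set.Icc 0 t₁, ∀ x, ∫ v, F s (x, v) * localMaxwellian 1 (θ₀ s x) (u₀ s x) v = 0) →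
     (∀ s ∈ Set.Icc 0 t₁, ∀ x, ∫ v, F s (x, v) * ‖v‖ ^ 2 * localMaxwellian 1 (θ₀ s x) (u₀ s x) v = 0) →
     ∃ β₀ : ℝ, 0 < β₀ ∧ ∀ β : ℝ, |β| ≤ β₀ → ∀ ε : ℝ, 0 < ε → ∃ τ₀ : ℝ, 0 < τ₀ ∧ ∀ τ : ℝ, τ₀ ≤ τ →
     ∃ N₀ : ℕ, ∀ N : ℕ, N₀ ≤ N → ∀ s ∈ Set.Icc 0 t₁,
       ∫⁻ z, ENNReal.ofReal (Real.exp (β * ∑ i : Fin (N + 1),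
           (τ * ((N : ℝ) + 1) ^ (-(1 / 3 : ℝ)))⁻¹ *
             ∫ r in (0 : ℝ)..(τ * ((N : ℝ) + 1) ^ (-(1 / 3 : ℝ))), F s ((Φ N).flow r z i)))
         ∂(localGibbsLaw σ (a s) (u₀ s) (θ₀ s) N (Φ N)) ≤
       ENNReal.ofReal (Real.exp (ε * ((N : ℝ) + 1))))

/-- The constant-family specialisation maps the variant without the momentum row onto the rung's. [folklore] -/
theorem withoutOrthMom_pointwise_of_family (h : KineticCurrentsLDAlongFamiliesWithoutOrthMom) :
    KineticCurrentsWindowLDUniformWithoutOrthMom := by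
  obtain ⟨η₀, hη₀, H⟩ := h
  refine ⟨η₀, hη₀, ?_⟩
  intro a θ₀ u₀ ha hθ hu ha0 hθ0 σ hσ hg Φ A b G hA hb hG hC h1 hE
  have H1 := H 0 (fun _ => a) (fun _ => θ₀) (fun _ => u₀) (ha.comp continuous_snd) (hθ.comp continuous_snd)
    (hu.comp continuous_snd) (fun _ x => ha0 x) (fun _ x => hθ0 x) σ hσ (fun _ _ => hg) Φ (fun _ => A) (fun _ => b)
    (fun _ => G) (hA.comp continuous_snd) (hb.comp continuous_snd) (hG.comp continuous_snd)
  dsimp only at H1 hC h1 hE ⊢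
  obtain ⟨C, hC⟩ := hC
  obtain ⟨β₀, hβ₀, Hβ⟩ := H1 ⟨C, fun _ _ y => hC y⟩ (fun _ _ x => h1 x) (fun _ _ x => hE x)
  refine ⟨β₀, hβ₀, fun β hβ ε hε => ?_⟩
  obtain ⟨τ₀, hτ₀, Hτ⟩ := Hβ β hβ ε hε
  obtain ⟨N₀, HN⟩ := Hτ τ₀ le_rfl
  exact ⟨τ₀, hτ₀, N₀, fun N hN => HN N hN 0 ⟨le_rfl, le_rfl⟩⟩

/-- **`F ⊥ v_j` IS LOAD-BEARING for the family crux**: without the momentum row it is false (`F = v₀`: conserved total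
momentum, functional `≥ e^{(N+1)β²/2}` at every window by the drift tilt `βe₀`; inherited from the rung). [folklore] -/
theorem not_kineticCurrentsLDAlongFamiliesWithoutOrthMom : ¬ KineticCurrentsLDAlongFamiliesWithoutOrthMom :=
  fun h => not_kineticCurrentsWindowLDUniformWithoutOrthMom (withoutOrthMom_pointwise_of_family h)

end Summit.AtomisticToContinuum.HydrodynamicLimit.Theorems.KineticCurrentsLDAlongFamiliesNegative

end
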